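import Summits.CriticalPhenomena.PercolationContinuityZ3.Theorems.FK.NewmanCovarianceInequality
import Summits.CriticalPhenomena.PercolationContinuityZ3.Theorems.FK.CharFunSecondOrder
import Literature.Probability.LatticeModels.ThermodynamicLimit
import HarnessLib

/-!
# NEWMAN'S BLOCK ARGUMENT, FINITE-VOLUME FORM: for a positively associated bounded increasing field `X` on `ℤ^d` with
# covariances `Cov(X_x, X_y) = γ(y − x)` and ANY finite region `A` cut into blocks,
# `|E e^{is(S_A − E S_A)} − exp(−s² W/2)| ≤ 2 s² (V − W) + #blocks · (|s|³K³ + s⁴K⁴)`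

Claimed R42 (8)(c) in the cell INBOX at 2026-08-28T13:11:28Z by fkp-10a gen 354 (NEW CLAIM #1 of the gen), under provision (ι) (no coordinator seated since gen 272's closing line l.8385: the lane lead absorbs the registry word, silence = consent; readers fk-ref / fkt-lead / fkp-18r / fkp-10b); lineage row FO-10a-g354 (self-suggested), package g354-newmanclt, label NC-D′.
Helper file of the `fk-continuity` build cell (bschramm lane; `--supports stmt-CriticalPhenomena-4575`); builds on
p205010 (kernel theorem, internal audit signed; external expert review pending). No definitions, no named facts, no
sorries; standard axioms. UNCONDITIONAL. GENERIC: a positively associated probability measure `μ` on a preordered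
measurable space, a field `X : Site d → Ω → ℝ` of increasing measurable functions with `|X_z| ≤ M` and
translation-covariant covariances `Cov(X_x, X_y) = γ(y − x)`; a finite region `A ⊆ ℤ^d` and an arbitrary "block label"
map `β : ℤ^d → ℤ^d` whose fibres in `A` have at most `κ` sites. With `S_A = Σ_{z∈A} X_z`, the block sums
`B_u = Σ_{z∈A, β z = u} X_z` (`u ∈ β(A)`), `V = Σ_{x,y∈A} γ(y−x) = Var S_A` and `W = Σ_u Σ_{x,y ∈ block u} γ(y−x) = Σ_u Var B_u`:

* `norm_integral_cexp_blockSum_sub_exp_le` — for `s²(2Mκ)² ≤ 2`,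
  `‖E exp(is(S_A − E S_A)) − exp(−s² W/2)‖ ≤ 2 s² (V − W) + #β(A) · (|s|³(2Mκ)³ + s⁴(2Mκ)⁴)`:
  Newman's inequality (`NewmanCovarianceInequality`) for the centred block sums — increasing, bounded by `2Mκ`, with
  `Σ_{u≠u'} Cov(B_u, B_{u'}) = V − W` — and the second-order product expansion (`CharFunSecondOrder`).
* the bookkeeping it rests on: `sum_sub_integral_eq_sum_blocks` (`S_A − E S_A = Σ_u (B_u − E B_u)`),
  `covariance_blockSum_eq` (`Cov(B_u, B_{u'}) = Σ_{x ∈ block u, y ∈ block u'} γ(y−x)`), `sum_sum_covSum_blocks_eq`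
  (`Σ_{u,u'} = V`), `covariance_kernel_nonneg` (`γ ≥ 0`), `sum_sum_kernel_nonneg` (`Σ_{x∈F,y∈F'} γ(y−x) ≥ 0`),
  `sum_covSum_blocks_le` (`W ≤ V`).

The infinite-volume limit along boxes (Newman's Thm. 2) is taken in `NewmanCLT.lean`.

## References

* C. M. Newman, *Normal fluctuations and the FKG inequalities*, Comm. Math. Phys. 74 (1980) 119–128, Thm. 1 (11),
  Thm. 2 and its proof ((1)–(3), (6)). [Newman1980]
* G. Grimmett, *The Random-Cluster Model*, Springer 2006, §4.3 Thm. (4.17)(b), (4.19)(b). [Grimmett2006]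
-/

noncomputable section

namespace Summit.CriticalPhenomena.PercolationContinuityZ3.Theorems.FK

namespace NewmanCLT

open MeasureTheory ProbabilityTheory Complex Finset
open Literature.Probability.Percolation Literature.Probability.LatticeModels

variable {Ω : Type*} {d : ℕ} {X : Site d → Ω → ℝ} {M : ℝ} {γ : Site d → ℝ}

/-! ### Finite sums of the field: monotonicity, bounds, covariances -/

/-- A finite sum of the field is increasing. [folklore] -/
theorem monotone_fieldSum [Preorder Ω] (hXmono : ∀ z, Monotone (X z)) (F : Finset (Site d)) :
    Monotone fun ω => ∑ z ∈ F, X z ω := fun _ _ h => Finset.sum_le_sum fun z _ => hXmono z h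

/-- `|Σ_{z∈F} X_z| ≤ M · #F`. [folklore] -/
theorem abs_fieldSum_le (hXb : ∀ z ω, |X z ω| ≤ M) (F : Finset (Site d)) (ω : Ω) :
    |∑ z ∈ F, X z ω| ≤ M * #F := by
  refine (Finset.abs_sum_le_sum_abs _ _).trans ?_
  rw [mul_comm]
  simpa using Finset.sum_le_sum fun z (_ : z ∈ F) => hXb z ω

section Measurable

variable [MeasurableSpace Ω] {μ : Measure Ω} [IsProbabilityMeasure μ]

/-- A finite sum of the field is measurable. [folklore] -/
theorem measurable_fieldSum (hXm : ∀ z, Measurable (X z)) (F : Finset (Site d)) :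
    Measurable fun ω => ∑ z ∈ F, X z ω := Finset.measurable_sum _ fun z _ => hXm z

/-- The centred block sum is bounded: `|Σ_{z∈F} X_z − E Σ_{z∈F} X_z| ≤ 2 M #F`. [folklore] -/
theorem abs_fieldSum_sub_integral_le (hXb : ∀ z ω, |X z ω| ≤ M) (F : Finset (Site d))
    (ω : Ω) : |∑ z ∈ F, X z ω - ∫ ω', ∑ z ∈ F, X z ω' ∂μ| ≤ 2 * M * #F := by
  have h1 := abs_fieldSum_le hXb F ω
  have h2 : |∫ ω', ∑ z ∈ F, X z ω' ∂μ| ≤ M * #F := by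
    have := norm_integral_le_of_norm_le_const (μ := μ) (f := fun ω' => ∑ z ∈ F, X z ω') (C := M * #F)
      (ae_of_all _ fun ω' => by rw [Real.norm_eq_abs]; exact abs_fieldSum_le hXb F ω')
    simpa using this
  have := abs_sub _ _ |>.trans (add_le_add h1 h2)
  linarith

/-- `X_z ∈ L²`. [folklore] -/
theorem memLp_field (hXm : ∀ z, Measurable (X z)) (hXb : ∀ z ω, |X z ω| ≤ M) (z : Site d) : MemLp (X z) 2 μ :=
  memLp_of_abs_le (hXm z) (hXb z) 2

/-- **Covariances of block sums**: `Cov(Σ_{x∈F} X_x, Σ_{y∈F'} X_y) = Σ_{x∈F} Σ_{y∈F'} γ(y − x)`.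
[cite: Newman1980, proof of Thm. 2] -/
theorem covariance_blockSum_eq (hXm : ∀ z, Measurable (X z)) (hXb : ∀ z ω, |X z ω| ≤ M)
    (hcov : ∀ x y, cov[X x, X y; μ] = γ (y - x)) (F F' : Finset (Site d)) :
    cov[fun ω => ∑ x ∈ F, X x ω, fun ω => ∑ y ∈ F', X y ω; μ] = ∑ x ∈ F, ∑ y ∈ F', γ (y - x) := by
  rw [covariance_fun_sum_fun_sum' (fun x _ => memLp_field hXm hXb x) (fun y _ => memLp_field hXm hXb y)]
  exact Finset.sum_congr rfl fun x _ => Finset.sum_congr rfl fun y _ => hcov x y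

/-- Centring does not change covariances of block sums. [folklore] -/
theorem covariance_blockSum_sub_integral_eq (hXm : ∀ z, Measurable (X z)) (hXb : ∀ z ω, |X z ω| ≤ M)
    (hcov : ∀ x y, cov[X x, X y; μ] = γ (y - x)) (F F' : Finset (Site d)) :
    cov[fun ω => ∑ x ∈ F, X x ω - ∫ ω', ∑ x ∈ F, X x ω' ∂μ, fun ω => ∑ y ∈ F', X y ω - ∫ ω', ∑ y ∈ F', X y ω' ∂μ; μ] =
      ∑ x ∈ F, ∑ y ∈ F', γ (y - x) := by
  have hi : ∀ G : Finset (Site d), Integrable (fun ω => ∑ x ∈ G, X x ω) μ := fun G =>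
    integrable_finsetSum _ fun x _ => integrable_of_abs_le (hXm x) (hXb x)
  rw [covariance_sub_const_left (hi F), covariance_sub_const_right (hi F')]
  exact covariance_blockSum_eq hXm hXb hcov F F'

/-- **The kernel is nonnegative**: `γ(z) = Cov(X_0, X_z) ≥ 0` by positive association. [cite: Newman1980, (10)] -/
theorem covariance_kernel_nonneg [Preorder Ω] (hμ : IsPositivelyAssociated μ) (hXm : ∀ z, Measurable (X z))
    (hXmono : ∀ z, Monotone (X z)) (hXb : ∀ z ω, |X z ω| ≤ M) (hcov : ∀ x y, cov[X x, X y; μ] = γ (y - x))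
    (z : Site d) : 0 ≤ γ z := by
  have h := covariance_nonneg_of_monotone hμ (hXmono 0) (hXmono z) (hXm 0) (hXm z) ⟨M, hXb 0⟩ ⟨M, hXb z⟩
  rwa [hcov, sub_zero] at h

/-- Double kernel sums are covariances of increasing block sums, hence nonnegative: `Σ_{x∈F, y∈F'} γ(y−x) ≥ 0`.
[cite: Newman1980, (10)] -/
theorem sum_sum_kernel_nonneg [Preorder Ω] (hμ : IsPositivelyAssociated μ) (hXm : ∀ z, Measurable (X z))
    (hXmono : ∀ z, Monotone (X z)) (hXb : ∀ z ω, |X z ω| ≤ M) (hcov : ∀ x y, cov[X x, X y; μ] = γ (y - x))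
    (F F' : Finset (Site d)) : 0 ≤ ∑ x ∈ F, ∑ y ∈ F', γ (y - x) := by
  rw [← covariance_blockSum_eq hXm hXb hcov F F']
  exact covariance_nonneg_of_monotone hμ (monotone_fieldSum hXmono F) (monotone_fieldSum hXmono F')
    (measurable_fieldSum hXm F) (measurable_fieldSum hXm F') ⟨_, abs_fieldSum_le hXb F⟩ ⟨_, abs_fieldSum_le hXb F'⟩

/-! ### Cutting a region into blocks -/

/-- **Centred sum = sum of centred block sums**: `S_A − E S_A = Σ_{u∈β(A)} (B_u − E B_u)`. [cite: Newman1980, (1)–(3)] -/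
theorem sum_sub_integral_eq_sum_blocks [DecidableEq (Site d)] (hXm : ∀ z, Measurable (X z)) (hXb : ∀ z ω, |X z ω| ≤ M)
    (A : Finset (Site d)) (β : Site d → Site d) (ω : Ω) :
    ∑ z ∈ A, X z ω - ∫ ω', ∑ z ∈ A, X z ω' ∂μ =
      ∑ u ∈ A.image β, (∑ z ∈ A.filter (fun z => β z = u), X z ω -
        ∫ ω', ∑ z ∈ A.filter (fun z => β z = u), X z ω' ∂μ) := by
  have hmaps : ∀ z ∈ A, β z ∈ A.image β := fun z hz => mem_image_of_mem β hz
  rw [Finset.sum_sub_distrib, Finset.sum_fiberwise_of_maps_to hmaps,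
    ← integral_finsetSum _ fun u _ => integrable_finsetSum _ fun x _ => integrable_of_abs_le (hXm x) (hXb x)]
  congr 1
  refine integral_congr_ae (ae_of_all _ fun ω' => ?_)
  exact (Finset.sum_fiberwise_of_maps_to hmaps _).symm

/-- **Summing block covariances recovers the variance**: `Σ_{u,u'∈β(A)} Σ_{x∈block u, y∈block u'} γ(y−x) = Σ_{x,y∈A} γ(y−x)`.
[cite: Newman1980, proof of Thm. 2] -/
theorem sum_sum_covSum_blocks_eq [DecidableEq (Site d)] (A : Finset (Site d)) (β : Site d → Site d) (γ : Site d → ℝ) :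
    ∑ u ∈ A.image β, ∑ u' ∈ A.image β, ∑ x ∈ A.filter (fun z => β z = u), ∑ y ∈ A.filter (fun z => β z = u'), γ (y - x) =
      ∑ x ∈ A, ∑ y ∈ A, γ (y - x) := by
  have hmaps : ∀ z ∈ A, β z ∈ A.image β := fun z hz => mem_image_of_mem β hz
  calc ∑ u ∈ A.image β, ∑ u' ∈ A.image β, ∑ x ∈ A.filter (fun z => β z = u), ∑ y ∈ A.filter (fun z => β z = u'), γ (y - x)
      = ∑ u ∈ A.image β, ∑ x ∈ A.filter (fun z => β z = u), ∑ u' ∈ A.image β, ∑ y ∈ A.filter (fun z => β z = u'), γ (y - x) :=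
        Finset.sum_congr rfl fun u _ => Finset.sum_comm
    _ = ∑ u ∈ A.image β, ∑ x ∈ A.filter (fun z => β z = u), ∑ y ∈ A, γ (y - x) :=
        Finset.sum_congr rfl fun u _ => Finset.sum_congr rfl fun x _ => Finset.sum_fiberwise_of_maps_to hmaps _
    _ = ∑ x ∈ A, ∑ y ∈ A, γ (y - x) := Finset.sum_fiberwise_of_maps_to hmaps _

/-- **`W ≤ V`**: the within-block part of the variance is at most the variance,
`Σ_{u∈β(A)} Σ_{x,y ∈ block u} γ(y−x) ≤ Σ_{x,y∈A} γ(y−x)` (the cross-block covariances are nonnegative by FKG).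
[cite: Newman1980, proof of Thm. 2] -/
theorem sum_covSum_blocks_le [Preorder Ω] [DecidableEq (Site d)] (hμ : IsPositivelyAssociated μ)
    (hXm : ∀ z, Measurable (X z)) (hXmono : ∀ z, Monotone (X z)) (hXb : ∀ z ω, |X z ω| ≤ M)
    (hcov : ∀ x y, cov[X x, X y; μ] = γ (y - x)) (A : Finset (Site d)) (β : Site d → Site d) :
    ∑ u ∈ A.image β, ∑ x ∈ A.filter (fun z => β z = u), ∑ y ∈ A.filter (fun z => β z = u), γ (y - x) ≤
      ∑ x ∈ A, ∑ y ∈ A, γ (y - x) := by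
  rw [← sum_sum_covSum_blocks_eq A β γ]
  exact Finset.sum_le_sum fun u hu => Finset.single_le_sum (f := fun u' => ∑ x ∈ A.filter (fun z => β z = u),
    ∑ y ∈ A.filter (fun z => β z = u'), γ (y - x)) (fun u' _ => sum_sum_kernel_nonneg hμ hXm hXmono hXb hcov _ _) hu

/-! ### The finite-volume estimate -/

/-- **NEWMAN'S BLOCK ESTIMATE (finite volume)**: for a positively associated `μ`, an increasing measurable field with
`|X_z| ≤ M`, `M ≥ 0`, covariances `γ(y − x)`, a finite region `A`, a label map `β` with fibres of at most `κ` sites in `A`,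
and `s² (2Mκ)² ≤ 2`:
`‖E exp(is(S_A − E S_A)) − exp(−s² W/2)‖ ≤ 2 s² (V − W) + #β(A) · (|s|³(2Mκ)³ + s⁴(2Mκ)⁴)`,
`V = Σ_{x,y∈A} γ(y−x)`, `W = Σ_{u∈β(A)} Σ_{x,y ∈ A ∩ β⁻¹u} γ(y−x)`. [cite: Newman1980, Thm. 1 (11) and proof of Thm. 2] -/
theorem norm_integral_cexp_blockSum_sub_exp_le [Preorder Ω] [DecidableEq (Site d)] (hμ : IsPositivelyAssociated μ)
    (hXm : ∀ z, Measurable (X z)) (hXmono : ∀ z, Monotone (X z)) (hM : 0 ≤ M) (hXb : ∀ z ω, |X z ω| ≤ M)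
    (hcov : ∀ x y, cov[X x, X y; μ] = γ (y - x)) (A : Finset (Site d)) (β : Site d → Site d) {κ : ℕ}
    (hfib : ∀ u, #(A.filter (fun z => β z = u)) ≤ κ) {s : ℝ} (hs : s ^ 2 * (2 * M * κ) ^ 2 ≤ 2) :
    ‖∫ ω, cexp (((s * (∑ z ∈ A, X z ω - ∫ ω', ∑ z ∈ A, X z ω' ∂μ) : ℝ) : ℂ) * I) ∂μ -
        ((Real.exp (-(s ^ 2 * (∑ u ∈ A.image β, ∑ x ∈ A.filter (fun z => β z = u),
          ∑ y ∈ A.filter (fun z => β z = u), γ (y - x)) / 2)) : ℝ) : ℂ)‖ ≤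
      2 * s ^ 2 * ((∑ x ∈ A, ∑ y ∈ A, γ (y - x)) -
          ∑ u ∈ A.image β, ∑ x ∈ A.filter (fun z => β z = u), ∑ y ∈ A.filter (fun z => β z = u), γ (y - x)) +
        #(A.image β) * (|s| ^ 3 * (2 * M * κ) ^ 3 + s ^ 4 * (2 * M * κ) ^ 4) := by
  -- the blocks and their centred sums
  set U : Finset (Site d) := A.image β with hU
  set F : Site d → Finset (Site d) := fun u => A.filter (fun z => β z = u) with hF
  set Z : Site d → Ω → ℝ := fun u ω => ∑ z ∈ F u, X z ω - ∫ ω', ∑ z ∈ F u, X z ω' ∂μ with hZ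
  set K : ℝ := 2 * M * κ with hK
  have hZm : ∀ u ∈ U, Measurable (Z u) := fun u _ => (measurable_fieldSum hXm (F u)).sub_const _
  have hZmono : ∀ u ∈ U, Monotone (Z u) := fun u _ ω ω' h => sub_le_sub_right (monotone_fieldSum hXmono (F u) h) _
  have hZK : ∀ u ∈ U, ∀ ω, |Z u ω| ≤ K := fun u _ ω => by
    refine (abs_fieldSum_sub_integral_le hXb (F u) ω).trans ?_
    simp only [hK]
    exact mul_le_mul_of_nonneg_left (by exact_mod_cast hfib u) (by positivity)
  have hZb : ∀ u ∈ U, ∃ C, ∀ ω, |Z u ω| ≤ C := fun u hu => ⟨K, hZK u hu⟩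
  have hZ0 : ∀ u ∈ U, ∫ ω, Z u ω ∂μ = 0 := fun u _ => by
    simp only [hZ]
    rw [integral_sub (integrable_finsetSum _ fun x _ => integrable_of_abs_le (hXm x) (hXb x)) (integrable_const _),
      integral_const, probReal_univ, one_smul, sub_self]
  -- Newman's inequality for the centred block sums, all coefficients equal to `s`
  have hN := norm_integral_cexp_sum_sub_prod_le hμ U hZm hZmono hZb (fun _ => s)
  -- the second-order product expansion
  have hP := norm_prod_integral_cexp_sub_exp_le (μ := μ) U hZm hZK hZ0 (s := s) (by simpa [hK] using hs)
  -- covariances of the centred block sums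
  have hcovZ : ∀ u u', cov[Z u, Z u'; μ] = ∑ x ∈ F u, ∑ y ∈ F u', γ (y - x) := fun u u' =>
    covariance_blockSum_sub_integral_eq hXm hXb hcov (F u) (F u')
  have hvarZ : ∀ u, Var[Z u; μ] = ∑ x ∈ F u, ∑ y ∈ F u, γ (y - x) := fun u => by
    rw [← covariance_self ((measurable_fieldSum hXm (F u)).sub_const _).aemeasurable, hcovZ]
  -- the double sum of Newman's bound is `s² (V − W)`
  have hsum : 2 * ∑ u ∈ U, ∑ u' ∈ U.erase u, |s| * |s| * cov[Z u, Z u'; μ] =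
      2 * s ^ 2 * ((∑ x ∈ A, ∑ y ∈ A, γ (y - x)) - ∑ u ∈ U, ∑ x ∈ F u, ∑ y ∈ F u, γ (y - x)) := by
    have habs : |s| * |s| = s ^ 2 := by rw [← abs_mul, ← sq, abs_of_nonneg (sq_nonneg s)]
    simp_rw [habs, hcovZ]
    rw [← sum_sum_covSum_blocks_eq A β γ, ← hU]
    have herase : ∀ u ∈ U, ∑ u' ∈ U.erase u, s ^ 2 * ∑ x ∈ F u, ∑ y ∈ F u', γ (y - x) =
        s ^ 2 * (∑ u' ∈ U, ∑ x ∈ F u, ∑ y ∈ F u', γ (y - x)) - s ^ 2 * ∑ x ∈ F u, ∑ y ∈ F u, γ (y - x) := by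
      intro u hu
      rw [← Finset.mul_sum, Finset.sum_erase_eq_sub hu, mul_sub]
    rw [Finset.sum_congr rfl herase, Finset.sum_sub_distrib, ← Finset.mul_sum, ← Finset.mul_sum]
    ring
  -- the integrand of the left-hand side is `exp(i Σ_u s Z_u)`
  have hlhs : ∀ ω, cexp (((s * (∑ z ∈ A, X z ω - ∫ ω', ∑ z ∈ A, X z ω' ∂μ) : ℝ) : ℂ) * I) =
      cexp (((∑ u ∈ U, s * Z u ω : ℝ) : ℂ) * I) := by
    intro ω
    rw [sum_sub_integral_eq_sum_blocks hXm hXb A β ω, Finset.mul_sum]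
  simp_rw [hlhs]
  rw [show (∑ u ∈ U, Var[Z u; μ]) = ∑ u ∈ U, ∑ x ∈ F u, ∑ y ∈ F u, γ (y - x) from
    Finset.sum_congr rfl fun u _ => hvarZ u] at hP
  rw [hsum] at hN
  calc _ ≤ ‖∫ ω, cexp (((∑ u ∈ U, s * Z u ω : ℝ) : ℂ) * I) ∂μ - ∏ u ∈ U, ∫ ω, cexp (((s * Z u ω : ℝ) : ℂ) * I) ∂μ‖ +
        ‖∏ u ∈ U, ∫ ω, cexp (((s * Z u ω : ℝ) : ℂ) * I) ∂μ -
          ((Real.exp (-(s ^ 2 * (∑ u ∈ U, ∑ x ∈ F u, ∑ y ∈ F u, γ (y - x)) / 2)) : ℝ) : ℂ)‖ :=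
        norm_sub_le_norm_sub_add_norm_sub _ _ _
    _ ≤ _ := add_le_add hN hP

end Measurable

end NewmanCLT

end Summit.CriticalPhenomena.PercolationContinuityZ3.Theorems.FK
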